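import Literature.Geometry.ComplexAnalytic.PhamBrieskornSuspendedNodeSphereTransversal
import Literature.Geometry.ComplexAnalytic.CyclicNodePencilShellSubmersion
import HarnessLib

/-!
# Near a suspended `A_{p−1}` point the pencil function and the chart radius are jointly submersive on the shells

Family `hodge`, layer `Literature/Geometry/ComplexAnalytic`; theorems only (no definition, no named fact). Written by the prover
seat `hodge-nonav-prover-Bx` (g16, cell `hodge-nonav`) as brick B4b of the programme «A₃-TRACE» (binder hN `stub_a3NonComm` of crux
K1-B `VeryGeneralSignCommutatorsInHg`, `Summits/HodgeConjecture/HodgeConjecture/Theses/SignSymmetricPowers.lean`,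
stmt-HodgeConjecture-19716; memo `HOME/memos/PROGRAMME-A3-TRACE-Bx-g16.md` §3): the analogue, for exponents `(2, …, 2, p)` in any
number `m + 2` of variables, of prover-Ax's `CyclicNodePencilShellSubmersion` (`(2, 2, p)`) and of `QuadricPencilShellSubmersion`
(`(2, …, 2)`).

Let `Θ` be a `C^∞` open partial homeomorphism of `ℂ^{m+2}` with `C^∞` inverse and `Σᵢ (Θ x)ᵢ^{aᵢ} = φ(x)` on its source — a chart
putting the pencil coordinate `φ` in the Pham–Brieskorn normal form `z₀² + ⋯ + zₘ² + z_{m+1}^p` (for the `A₃` point: `p = 4`,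
memo B4a). With the chart radius `r(x) = Σᵢ |(Θ x)ᵢ|²`:

* **`surjective_fderiv_pencil_suspendedRadius_of_shell`** — `x ↦ (φ(x), r(x))` has onto real differential at every
  `x ∈ Θ.source` with `r₀² ≤ r(x) ≤ r₂²` and `|φ(x)| < r₀^p` (`0 < r₀ ≤ r₂ < 1`, `r₂^{p−2} < 2/p`, `p ≥ 3`): `(φ, r) = (P, ρ) ∘ Θ`
  near `x`, the model map is submersive there (`surjective_fderiv_suspendedNodeLevelRadius_of_shell`) and `DΘ(x)` is invertible
  (`hasFDerivAt_equiv_of_contDiffOn_symm`).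

This is the Euclidean input `hsurj₂` of the tangent-lift lemma `Geometry/Manifold/SubmersionLiftVectorField` for the pencil near
the `A₃` point: the lifted translation fields can be chosen tangent to the chart shells. Local computation only; HC not proved.

## References

* [Milnor1968] J. Milnor, Singular Points of Complex Hypersurfaces (1968), §4 and Lemma 5.9–5.10 (the spheres `S_ε` are transverse
  to the fibres near an isolated critical point).
* [ArnoldGuseinzadeVarchenko2012] V. I. Arnold, S. M. Gusein-Zade, A. N. Varchenko, Singularities of Differentiable Maps II (2012),
  Part I §2.1 (the Milnor fibration in a ball), §2.3.
-/

noncomputable section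

open Complex ComplexConjugate Set Filter Topology
open scoped BigOperators ContDiff

namespace Literature.Geometry.ComplexAnalytic

section Submersion

variable {m : ℕ} {a : Fin (m + 2) → ℕ} {p : ℕ} (h2 : ∀ i : Fin (m + 1), a i.castSucc = 2) (hp : a (Fin.last (m + 1)) = p)
include h2 hp

/-- **Joint submersion of `(φ, r)` on the shells, in the pencil coordinates** (exponents `(2, …, 2, p)`). Let `Θ` be a `C^∞` open
partial homeomorphism of `ℂ^{m+2}` with `C^∞` inverse and `Σᵢ (Θ x)ᵢ^{aᵢ} = φ(x)` on its source. For `0 < r₀ ≤ r₂ < 1`,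
`r₂^{p−2} < 2/p`, `p ≥ 3`, at every `x ∈ Θ.source` with `r₀² ≤ Σᵢ |(Θ x)ᵢ|² ≤ r₂²` and `|φ(x)| < r₀^p`, the real differential of
`x ↦ (φ(x), Σᵢ |(Θ x)ᵢ|²)` is onto. [cite: Milnor1968, Lemma 5.10] [cite: ArnoldGuseinzadeVarchenko2012, Part I §2.1] -/
theorem surjective_fderiv_pencil_suspendedRadius_of_shell (hp3 : 3 ≤ p)
    (Θ : OpenPartialHomeomorph (Fin (m + 2) → ℂ) (Fin (m + 2) → ℂ))
    (hΘ : ContDiffOn ℝ ∞ Θ Θ.source) (hΘs : ContDiffOn ℝ ∞ Θ.symm Θ.target)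
    (φ : (Fin (m + 2) → ℂ) → ℂ) (hΘφ : ∀ x ∈ Θ.source, ∑ i, (Θ x) i ^ a i = φ x)
    {r₀ r₂ : ℝ} (hr₀ : 0 < r₀) (hr₀₂ : r₀ ≤ r₂) (hr₂ : r₂ < 1) (hr₂' : r₂ ^ (p - 2) < 2 / p)
    {x : Fin (m + 2) → ℂ} (hx : x ∈ Θ.source)
    (hlow : r₀ ^ 2 ≤ ∑ i, ‖Θ x i‖ ^ 2) (hup : ∑ i, ‖Θ x i‖ ^ 2 ≤ r₂ ^ 2) (hφ : ‖φ x‖ < r₀ ^ p) :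
    Function.Surjective (fderiv ℝ (fun x : Fin (m + 2) → ℂ => ((φ x : ℂ), (∑ i, ‖Θ x i‖ ^ 2 : ℝ))) x) := by
  haveI : CompleteSpace (Fin (m + 2) → ℂ) := inferInstance
  -- the model map and its derivative at `z = Θ x`
  set G : (Fin (m + 2) → ℂ) → ℂ × ℝ := fun z => ((∑ i, z i ^ a i : ℂ), (∑ i, ‖z i‖ ^ 2 : ℝ)) with hG
  obtain ⟨LG, hLG, -⟩ := PhamBrieskorn.hasFDerivAt_levelRadius a (Θ x)
  have hP : ‖∑ i, Θ x i ^ a i‖ < r₀ ^ p := by rw [hΘφ x hx]; exact hφ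
  have hsurjG : Function.Surjective (fderiv ℝ G (Θ x)) :=
    PhamBrieskorn.surjective_fderiv_suspendedNodeLevelRadius_of_shell h2 hp hp3 hr₀ hr₀₂ hr₂ hr₂' hlow hup hP
  rw [hLG.fderiv] at hsurjG
  -- the chart derivative
  obtain ⟨L, hL⟩ := PhamBrieskorn.hasFDerivAt_equiv_of_contDiffOn_symm Θ hΘ hΘs hx
  -- `(φ, r) = G ∘ Θ` near `x`
  have hcomp : HasFDerivAt (fun x : Fin (m + 2) → ℂ => ((φ x : ℂ), (∑ i, ‖Θ x i‖ ^ 2 : ℝ)))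
      (LG.comp (L : (Fin (m + 2) → ℂ) →L[ℝ] (Fin (m + 2) → ℂ))) x := by
    refine (hLG.comp x hL).congr_of_eventuallyEq ?_
    filter_upwards [Θ.open_source.mem_nhds hx] with x' hx'
    simp only [Function.comp_apply, hΘφ x' hx']
  rw [hcomp.fderiv, ContinuousLinearMap.coe_comp]
  exact hsurjG.comp L.surjective

end Submersion

end Literature.Geometry.ComplexAnalytic

end
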